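import Summits.Ventures.CertifiedManyBodySolver.Upper.IntervalReaderBytes
import HarnessLib

/-!
# Ventures/CertifiedManyBodySolver — Upper/IntervalReaderLimbKappa.lean: the limb backend's floating-point
row sums (Theorem H1′, part 27)

HONEST FRAMING: first certified bounds; not a superconductivity verdict; every number certified (two
readers) or labelled float.  This file is about A READER'S OWN ARITHMETIC (`l3core/limb.py`, binary of record
`l3core 0.6.9` 5fda02e5cf27520d, the same substrate under `l3core-sgf 0.1.11`) and says nothing about the
Hubbard model, a producer, a row, or the thermodynamic limit.

Parts 2 / 12 take the Gram constant as a HYPOTHESIS `∀ i, Σ_j ‖G i j‖ ≤ κ` (`gram_kappas`: the maximum absolute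
row sum of the exact integer Gram matrix).  The pure / flint backends compute that maximum exactly; the LIMB
backend (`limb.max_abs_rowsum_upper`) computes it in binary64 — `f = |to_float(M)|` (Horner over the limbs, top
limb first: `acc = acc·2^W + limb`), `rs = f.sum(axis=1).max()`, then `int(rs·(1 + 2^−30)) + 2` — and the
non-author precision P2 (ref-2c g25, HOME INBOX l.25154) records that bound as the one undischarged analytic
input of the limb backend.  This part supplies the ENTRYWISE analysis (part 28 `IntervalReaderLimbRowSum`
adds the row sums in any bracketing and assembles the bound `Σ_b |M a b| ≤ int(rs·(1 + 2^−30)) + 2`):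
* §A `hornerExact` (`= Σ_i 2^(W i)·l i`; `limbMatVal_apply`) and `hornerRd` (= `to_float`, EVERY binary64
  operation rounded by an abstract `rd`);
* §B–§C **`hornerRd_inv`**: TWO REGIMES — the evaluation is EXACT until an intermediate exceeds `2^53`
  (`horner_step_exact`); from then on every exact intermediate has modulus `≥ 2^53 − 2^20` and the relative
  error grows by at most `3·2^−53` per limb (`horner_step_large`); hence **`abs_hornerRd_ge`**:
  `|to_float entry| ≥ (1 − 3K·2^−53)·|entry|` whenever `3K·2^−53 ≤ 2^−30`, and the computed modulus is `0` or `≥ 1`.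
PREMISES — explicit hypotheses on `rd : ℝ → ℝ`, never axioms: (A1) `rd` fixes every integer of modulus `≤ 2^53`
(part 25 `rd_intCast_of_nearest`); (A2) the STANDARD MODEL `|rd x − x| ≤ 2^−53·|x|` for `|x| ≥ 1/2` (IEEE-754
binary64 round-to-nearest obeys it on the whole normal range; every nonzero quantity rounded here has modulus
`≥ 1/2`).  Outside the model: overflow (an entry `≥ 2^1024`, i.e. from 52 limbs on, makes `to_float` return `inf`
and `int(inf)` RAISE — an error row, never a verdict); `·2^W` is exact in IEEE and (harmlessly) rounded here.
-/

noncomputable section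

open Matrix Finset

namespace Summit.Ventures.CertifiedManyBodySolver.Upper.IntervalReader

/-! ## §A  Horner evaluation of a limb stack: exact and rounded -/

/-- The exact value of a limb sequence `l : Fin K → ℤ` (limb `0` least significant), as the Horner recursion
`2^W · (value of the tail) + l 0`. -/
def hornerExact : {K : ℕ} → (Fin K → ℤ) → ℤ
  | 0, _ => 0
  | _ + 1, l => 2 ^ limbWidth * hornerExact (Fin.tail l) + l 0

/-- `hornerExact l = Σ_i 2^(W·i) · l i`. -/
theorem hornerExact_eq_sum : ∀ {K : ℕ} (l : Fin K → ℤ),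
    hornerExact l = ∑ i : Fin K, 2 ^ (limbWidth * (i : ℕ)) * l i
  | 0, _ => by simp [hornerExact]
  | K + 1, l => by
      rw [hornerExact, Fin.sum_univ_succ, hornerExact_eq_sum (Fin.tail l), Finset.mul_sum]
      have : ∀ i : Fin K, (2 : ℤ) ^ limbWidth * (2 ^ (limbWidth * (i : ℕ)) * Fin.tail l i)
          = 2 ^ (limbWidth * ((i.succ : Fin (K + 1)) : ℕ)) * l i.succ := fun i => by
        rw [Fin.val_succ, Nat.mul_succ, pow_add, Fin.tail]; ring
      rw [Finset.sum_congr rfl fun i _ => this i]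
      simp [add_comm]

/-- The entries of a limb-stacked matrix are the Horner values of their limb sequences. -/
theorem limbMatVal_apply {μ ν : Type*} {K : ℕ} (L : Fin K → Matrix μ ν ℤ) (a : μ) (b : ν) :
    limbMatVal L a b = hornerExact (fun i => L i a b) := by
  simp only [limbMatVal, hornerExact_eq_sum, Matrix.sum_apply, Matrix.smul_apply, smul_eq_mul]

/-- `limb.to_float`, one entry: `acc = top limb` (an exact conversion, `|limb| ≤ 2^20`), then for every lower
limb `acc = rd (rd (2^W · acc) + limb)` — every binary64 operation rounded by `rd`. -/
def hornerRd (rd : ℝ → ℝ) : {K : ℕ} → (Fin K → ℤ) → ℝ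
  | 0, _ => 0
  | 1, l => (l 0 : ℝ)
  | _ + 2, l => rd (rd (2 ^ limbWidth * hornerRd rd (Fin.tail l)) + (l 0 : ℝ))

/-! ## §B  The two regimes of one Horner step -/

/-- **Ignition step.**  Tail exact so far (`X ∈ ℤ` the shifted tail value), lower limb `0 ≤ l₀ ≤ 2^20`, `v = X + l₀`:
either `rd (rd X + l₀) = v` exactly, or `|v| ≥ 2^53 − 2^20` and the relative error is `≤ 3·2^−53`. -/
theorem horner_step_exact {rd : ℝ → ℝ}
    (hsm : ∀ x : ℝ, 1 / 2 ≤ |x| → |rd x - x| ≤ |x| / 2 ^ 53)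
    (hint : ∀ z : ℤ, |z| ≤ 2 ^ 53 → rd (z : ℝ) = z)
    (X l₀ : ℤ) (hl₀ : 0 ≤ l₀) (hl₀' : (l₀ : ℝ) ≤ 2 ^ 20) :
    rd (rd (X : ℝ) + (l₀ : ℝ)) = ((X + l₀ : ℤ) : ℝ) ∨
      ((2 : ℝ) ^ 53 - 2 ^ 20 ≤ |((X + l₀ : ℤ) : ℝ)| ∧
        |rd (rd (X : ℝ) + (l₀ : ℝ)) - ((X + l₀ : ℤ) : ℝ)| ≤ 3 / 2 ^ 53 * |((X + l₀ : ℤ) : ℝ)|) := by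
  have hc : ((X + l₀ : ℤ) : ℝ) = (X : ℝ) + (l₀ : ℝ) := by push_cast; ring
  have hl₀R : (0 : ℝ) ≤ l₀ := by exact_mod_cast hl₀
  rw [hc]
  by_cases hX : |X| ≤ 2 ^ 53
  · rw [hint X hX]
    by_cases hv : |X + l₀| ≤ 2 ^ 53
    · left
      have := hint _ hv; rwa [hc] at this
    · right
      have hv' : (2 : ℝ) ^ 53 < |(X : ℝ) + l₀| := by
        have : (2 : ℝ) ^ 53 < |((X + l₀ : ℤ) : ℝ)| := by exact_mod_cast (not_le.mp hv)
        rwa [hc] at this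
      refine ⟨by linarith, ?_⟩
      have hnn : 0 ≤ |(X : ℝ) + l₀| := abs_nonneg _
      calc |rd ((X : ℝ) + l₀) - ((X : ℝ) + l₀)|
          ≤ |(X : ℝ) + l₀| / 2 ^ 53 := hsm _ (by linarith)
        _ ≤ 3 / 2 ^ 53 * |(X : ℝ) + l₀| := by linarith
  · right
    have hXR : (2 : ℝ) ^ 53 < |(X : ℝ)| := by exact_mod_cast (not_le.mp hX)
    have hvX : |(X : ℝ)| - 2 ^ 20 ≤ |(X : ℝ) + l₀| := by
      have := abs_sub_abs_le_abs_sub (X : ℝ) (-(l₀ : ℝ))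
      rw [sub_neg_eq_add, abs_neg, abs_of_nonneg hl₀R] at this
      linarith
    have hv0 : (2 : ℝ) ^ 53 - 2 ^ 20 ≤ |(X : ℝ) + l₀| := by linarith
    refine ⟨hv0, ?_⟩
    have hy : |rd (X : ℝ) - X| ≤ |(X : ℝ)| / 2 ^ 53 := hsm _ (by linarith)
    have hzv : |(rd (X : ℝ) + l₀) - ((X : ℝ) + l₀)| ≤ |(X : ℝ)| / 2 ^ 53 := by
      have : (rd (X : ℝ) + l₀) - ((X : ℝ) + l₀) = rd (X : ℝ) - X := by ring
      rw [this]; exact hy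
    have hz_upper : |rd (X : ℝ) + l₀| ≤ |(X : ℝ) + l₀| + |(X : ℝ)| / 2 ^ 53 := by
      have := abs_sub_abs_le_abs_sub (rd (X : ℝ) + l₀) ((X : ℝ) + l₀)
      linarith
    have hz_lower : |(X : ℝ) + l₀| - |(X : ℝ)| / 2 ^ 53 ≤ |rd (X : ℝ) + l₀| := by
      have := abs_sub_abs_le_abs_sub ((X : ℝ) + l₀) (rd (X : ℝ) + l₀)
      rw [abs_sub_comm] at this
      linarith
    have hXv : |(X : ℝ)| ≤ (1 + 1 / 2 ^ 32) * |(X : ℝ) + l₀| := by linarith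
    have hres : |rd (rd (X : ℝ) + l₀) - (rd (X : ℝ) + l₀)| ≤ |rd (X : ℝ) + l₀| / 2 ^ 53 :=
      hsm _ (by linarith)
    have hnn : 0 ≤ |(X : ℝ) + l₀| := abs_nonneg _
    have hnum : ((1 : ℝ) + (1 + 1 / 2 ^ 32) / 2 ^ 53) / 2 ^ 53 + (1 + 1 / 2 ^ 32) / 2 ^ 53 ≤ 3 / 2 ^ 53 := by
      norm_num
    calc |rd (rd (X : ℝ) + l₀) - ((X : ℝ) + l₀)|
        ≤ |rd (rd (X : ℝ) + l₀) - (rd (X : ℝ) + l₀)| + |(rd (X : ℝ) + l₀) - ((X : ℝ) + l₀)| :=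
          abs_sub_le _ _ _
      _ ≤ |rd (X : ℝ) + l₀| / 2 ^ 53 + |(X : ℝ)| / 2 ^ 53 := add_le_add hres hzv
      _ ≤ (|(X : ℝ) + l₀| + (1 + 1 / 2 ^ 32) * |(X : ℝ) + l₀| / 2 ^ 53) / 2 ^ 53
            + (1 + 1 / 2 ^ 32) * |(X : ℝ) + l₀| / 2 ^ 53 := by
          gcongr
          · linarith
      _ = (((1 : ℝ) + (1 + 1 / 2 ^ 32) / 2 ^ 53) / 2 ^ 53 + (1 + 1 / 2 ^ 32) / 2 ^ 53) * |(X : ℝ) + l₀| := by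
          ring
      _ ≤ 3 / 2 ^ 53 * |(X : ℝ) + l₀| := mul_le_mul_of_nonneg_right hnum hnn

/-- **Post-ignition step.**  If the shifted exact tail `X` has `|X| ≥ 2^20·(2^53 − 2^20)` and the shifted computed
tail `x` is within relative error `ε ≤ 2^−30` of it, then for `v = X + l₀` (`0 ≤ l₀ ≤ 2^20`) again
`|v| ≥ 2^53 − 2^20` and `rd (rd x + l₀)` is within relative error `ε + 3·2^−53` of `v`. -/
theorem horner_step_large {rd : ℝ → ℝ}
    (hsm : ∀ x : ℝ, 1 / 2 ≤ |x| → |rd x - x| ≤ |x| / 2 ^ 53)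
    {X x l₀ ε : ℝ} (hl₀ : 0 ≤ l₀) (hl₀' : l₀ ≤ 2 ^ 20) (hε0 : 0 ≤ ε) (hε1 : ε ≤ 1 / 2 ^ 30)
    (hX : (2 : ℝ) ^ 20 * (2 ^ 53 - 2 ^ 20) ≤ |X|) (hx : |x - X| ≤ ε * |X|) :
    (2 : ℝ) ^ 53 - 2 ^ 20 ≤ |X + l₀| ∧
      |rd (rd x + l₀) - (X + l₀)| ≤ (ε + 3 / 2 ^ 53) * |X + l₀| := by
  have hvX : |X| - 2 ^ 20 ≤ |X + l₀| := by
    have := abs_sub_abs_le_abs_sub X (-l₀)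
    rw [sub_neg_eq_add, abs_neg, abs_of_nonneg hl₀] at this
    linarith
  have hbig : (2 : ℝ) ^ 20 * (2 ^ 53 - 2 ^ 20) - 2 ^ 20 ≤ |X + l₀| := by linarith
  have hv0 : (2 : ℝ) ^ 53 - 2 ^ 20 ≤ |X + l₀| := le_trans (by norm_num) hbig
  refine ⟨hv0, ?_⟩
  have hη : |X| ≤ (1 + 1 / 2 ^ 32) * |X + l₀| := by
    have : (2 : ℝ) ^ 20 ≤ |X + l₀| / 2 ^ 32 := by
      rw [le_div_iff₀ (by positivity)]
      exact le_trans (by norm_num) hbig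
    linarith
  have hXnn : 0 ≤ |X| := abs_nonneg _
  have hεX : ε * |X| ≤ 1 / 2 ^ 30 * |X| := mul_le_mul_of_nonneg_right hε1 hXnn
  have hx_lower : |X| - ε * |X| ≤ |x| := by
    have := abs_sub_abs_le_abs_sub X x
    rw [abs_sub_comm] at this
    linarith
  have hx_upper : |x| ≤ |X| + ε * |X| := by
    have := abs_sub_abs_le_abs_sub x X
    linarith
  have hx_half : 1 / 2 ≤ |x| := by
    have h1 : (1 : ℝ) / 2 ≤ (1 - 1 / 2 ^ 30) * (2 ^ 20 * (2 ^ 53 - 2 ^ 20)) := by norm_num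
    have h2 : (1 - 1 / 2 ^ 30) * ((2 : ℝ) ^ 20 * (2 ^ 53 - 2 ^ 20)) ≤ (1 - 1 / 2 ^ 30) * |X| :=
      mul_le_mul_of_nonneg_left hX (by norm_num)
    linarith
  have hy : |rd x - x| ≤ |x| / 2 ^ 53 := hsm _ hx_half
  -- |rd x - X| ≤ δ |X| with δ = (1 + ε)/2^53 + ε
  have hyX : |rd x - X| ≤ ((1 + ε) / 2 ^ 53 + ε) * |X| :=
    calc |rd x - X| ≤ |rd x - x| + |x - X| := abs_sub_le _ _ _
      _ ≤ |x| / 2 ^ 53 + ε * |X| := add_le_add hy hx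
      _ ≤ (|X| + ε * |X|) / 2 ^ 53 + ε * |X| := by gcongr
      _ = ((1 + ε) / 2 ^ 53 + ε) * |X| := by ring
  have hδ1 : (1 + ε) / 2 ^ 53 + ε ≤ 1 / 2 ^ 29 := by
    have : (1 + ε) / 2 ^ 53 ≤ (1 + 1 / 2 ^ 30) / (2 : ℝ) ^ 53 := by gcongr
    have h2 : (1 + 1 / 2 ^ 30) / (2 : ℝ) ^ 53 + 1 / 2 ^ 30 ≤ 1 / 2 ^ 29 := by norm_num
    linarith
  have hδX : ((1 + ε) / 2 ^ 53 + ε) * |X| ≤ 1 / 2 ^ 29 * |X| := mul_le_mul_of_nonneg_right hδ1 hXnn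
  have hzv : |(rd x + l₀) - (X + l₀)| ≤ ((1 + ε) / 2 ^ 53 + ε) * |X| := by
    have : (rd x + l₀) - (X + l₀) = rd x - X := by ring
    rw [this]; exact hyX
  have hz_upper : |rd x + l₀| ≤ |X + l₀| + ((1 + ε) / 2 ^ 53 + ε) * |X| := by
    have := abs_sub_abs_le_abs_sub (rd x + l₀) (X + l₀)
    linarith
  have hz_lower : |X + l₀| - ((1 + ε) / 2 ^ 53 + ε) * |X| ≤ |rd x + l₀| := by
    have := abs_sub_abs_le_abs_sub (X + l₀) (rd x + l₀)
    rw [abs_sub_comm] at this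
    linarith
  have hz_half : 1 / 2 ≤ |rd x + l₀| := by
    have : 1 / 2 ^ 29 * |X| ≤ 1 / 2 ^ 29 * ((1 + 1 / 2 ^ 32) * |X + l₀|) :=
      mul_le_mul_of_nonneg_left hη (by norm_num)
    nlinarith
  have hres : |rd (rd x + l₀) - (rd x + l₀)| ≤ |rd x + l₀| / 2 ^ 53 := hsm _ hz_half
  have hnn : 0 ≤ |X + l₀| := abs_nonneg _
  have hδ0 : 0 ≤ (1 + ε) / 2 ^ 53 + ε := by positivity
  have hcoef : (1 + ((1 + ε) / 2 ^ 53 + ε) * (1 + 1 / 2 ^ 32)) / (2 : ℝ) ^ 53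
      + ((1 + ε) / 2 ^ 53 + ε) * (1 + 1 / 2 ^ 32) ≤ ε + 3 / 2 ^ 53 := by
    linarith
  calc |rd (rd x + l₀) - (X + l₀)|
      ≤ |rd (rd x + l₀) - (rd x + l₀)| + |(rd x + l₀) - (X + l₀)| := abs_sub_le _ _ _
    _ ≤ |rd x + l₀| / 2 ^ 53 + ((1 + ε) / 2 ^ 53 + ε) * |X| := add_le_add hres hzv
    _ ≤ (|X + l₀| + ((1 + ε) / 2 ^ 53 + ε) * |X|) / 2 ^ 53 + ((1 + ε) / 2 ^ 53 + ε) * |X| := by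
        gcongr
    _ ≤ (|X + l₀| + ((1 + ε) / 2 ^ 53 + ε) * ((1 + 1 / 2 ^ 32) * |X + l₀|)) / 2 ^ 53
          + ((1 + ε) / 2 ^ 53 + ε) * ((1 + 1 / 2 ^ 32) * |X + l₀|) := by gcongr
    _ = ((1 + ((1 + ε) / 2 ^ 53 + ε) * (1 + 1 / 2 ^ 32)) / (2 : ℝ) ^ 53
          + ((1 + ε) / 2 ^ 53 + ε) * (1 + 1 / 2 ^ 32)) * |X + l₀| := by ring
    _ ≤ (ε + 3 / 2 ^ 53) * |X + l₀| := mul_le_mul_of_nonneg_right hcoef hnn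

/-! ## §C  The invariant of `to_float` and the entrywise lower bound -/

/-- **`to_float`, entrywise (the invariant).**  For a limb sequence in normal form (lower limbs in `[0, 2^W)`)
with `3K·2^−53 ≤ 2^−30`: EITHER the Horner evaluation is exact, OR the exact value has modulus `≥ 2^53 − 2^20`
and the computed one is within relative error `3K·2^−53` of it. -/
theorem hornerRd_inv {rd : ℝ → ℝ}
    (hsm : ∀ x : ℝ, 1 / 2 ≤ |x| → |rd x - x| ≤ |x| / 2 ^ 53)
    (hint : ∀ z : ℤ, |z| ≤ 2 ^ 53 → rd (z : ℝ) = z) :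
    ∀ {K : ℕ} (l : Fin K → ℤ), (∀ i : Fin K, (i : ℕ) + 1 < K → 0 ≤ l i ∧ l i < 2 ^ limbWidth) →
      3 * (K : ℝ) / 2 ^ 53 ≤ 1 / 2 ^ 30 →
      hornerRd rd l = hornerExact l ∨
        ((2 : ℝ) ^ 53 - 2 ^ 20 ≤ |(hornerExact l : ℝ)| ∧
          |hornerRd rd l - hornerExact l| ≤ 3 * (K : ℝ) / 2 ^ 53 * |(hornerExact l : ℝ)|)
  | 0, l, _, _ => Or.inl (by simp [hornerRd, hornerExact])
  | 1, l, _, _ => Or.inl (by simp [hornerRd, hornerExact])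
  | K + 2, l, hlow, hK => by
      have hl0 := hlow 0 (by simp)
      have htail : ∀ i : Fin (K + 1), (i : ℕ) + 1 < K + 1 →
          0 ≤ Fin.tail l i ∧ Fin.tail l i < 2 ^ limbWidth :=
        fun i hi => hlow i.succ (by simp; omega)
      have hK' : 3 * ((K + 1 : ℕ) : ℝ) / 2 ^ 53 ≤ 1 / 2 ^ 30 := by
        refine le_trans ?_ hK; push_cast; linarith
      have hW : (2 : ℝ) ^ limbWidth = 2 ^ 20 := by norm_num [limbWidth]
      have h2pos : (0 : ℝ) < 2 ^ limbWidth := by positivity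
      have hl0R' : ((l 0 : ℤ) : ℝ) ≤ 2 ^ 20 := by
        have : ((l 0 : ℤ) : ℝ) < (2 : ℝ) ^ limbWidth := by exact_mod_cast hl0.2
        rw [hW] at this; exact this.le
      have hvc : ((hornerExact l : ℤ) : ℝ) = 2 ^ limbWidth * (hornerExact (Fin.tail l) : ℝ) + (l 0 : ℝ) := by
        rw [hornerExact]; push_cast; ring
      have hrd : hornerRd rd l = rd (rd (2 ^ limbWidth * hornerRd rd (Fin.tail l)) + (l 0 : ℝ)) := by
        rw [hornerRd]
      rcases hornerRd_inv hsm hint (Fin.tail l) htail hK' with hex | ⟨hbig, herr⟩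
      · -- exact so far: ignition step
        have hstep := horner_step_exact hsm hint (2 ^ limbWidth * hornerExact (Fin.tail l)) (l 0) hl0.1 hl0R'
        have hcX : ((2 ^ limbWidth * hornerExact (Fin.tail l) : ℤ) : ℝ)
            = 2 ^ limbWidth * (hornerExact (Fin.tail l) : ℝ) := by push_cast; ring
        have hcv : ((2 ^ limbWidth * hornerExact (Fin.tail l) + l 0 : ℤ) : ℝ) = (hornerExact l : ℝ) := by
          rw [hvc]; push_cast; ring
        rw [hcX, hcv] at hstep
        rw [hrd, hex]
        rcases hstep with h | ⟨h1, h2⟩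
        · exact Or.inl h
        · refine Or.inr ⟨h1, h2.trans (mul_le_mul_of_nonneg_right ?_ (abs_nonneg _))⟩
          push_cast
          have : (0 : ℝ) ≤ K := Nat.cast_nonneg K
          linarith
      · -- large regime
        have hε0 : (0 : ℝ) ≤ 3 * ((K + 1 : ℕ) : ℝ) / 2 ^ 53 := by positivity
        have hl0R : (0 : ℝ) ≤ (l 0 : ℝ) := by exact_mod_cast hl0.1
        have hX : (2 : ℝ) ^ 20 * (2 ^ 53 - 2 ^ 20) ≤ |2 ^ limbWidth * (hornerExact (Fin.tail l) : ℝ)| := by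
          rw [abs_mul, abs_of_pos h2pos, hW]
          exact mul_le_mul_of_nonneg_left hbig (by norm_num)
        have hx : |2 ^ limbWidth * hornerRd rd (Fin.tail l) - 2 ^ limbWidth * (hornerExact (Fin.tail l) : ℝ)|
            ≤ 3 * ((K + 1 : ℕ) : ℝ) / 2 ^ 53 * |2 ^ limbWidth * (hornerExact (Fin.tail l) : ℝ)| := by
          rw [← mul_sub, abs_mul, abs_mul, abs_of_pos h2pos]
          calc 2 ^ limbWidth * |hornerRd rd (Fin.tail l) - hornerExact (Fin.tail l)|
              ≤ 2 ^ limbWidth * (3 * ((K + 1 : ℕ) : ℝ) / 2 ^ 53 * |(hornerExact (Fin.tail l) : ℝ)|) :=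
                mul_le_mul_of_nonneg_left herr h2pos.le
            _ = 3 * ((K + 1 : ℕ) : ℝ) / 2 ^ 53 * (2 ^ limbWidth * |(hornerExact (Fin.tail l) : ℝ)|) := by
                ring
        have hstep := horner_step_large hsm hl0R hl0R' hε0 hK' hX hx
        rw [hrd, hvc]
        refine Or.inr ⟨hstep.1, hstep.2.trans (le_of_eq ?_)⟩
        congr 1
        push_cast
        ring

/-- **Entrywise lower bound.**  `|to_float entry| ≥ (1 − 3K·2^−53) · |entry|`, and the computed modulus is
`0` or `≥ 1`. -/
theorem abs_hornerRd_ge {rd : ℝ → ℝ}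
    (hsm : ∀ x : ℝ, 1 / 2 ≤ |x| → |rd x - x| ≤ |x| / 2 ^ 53)
    (hint : ∀ z : ℤ, |z| ≤ 2 ^ 53 → rd (z : ℝ) = z) {K : ℕ} (l : Fin K → ℤ)
    (hlow : ∀ i : Fin K, (i : ℕ) + 1 < K → 0 ≤ l i ∧ l i < 2 ^ limbWidth)
    (hK : 3 * (K : ℝ) / 2 ^ 53 ≤ 1 / 2 ^ 30) :
    (1 - 3 * (K : ℝ) / 2 ^ 53) * |(hornerExact l : ℝ)| ≤ |hornerRd rd l| ∧
      (|hornerRd rd l| = 0 ∨ 1 ≤ |hornerRd rd l|) := by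
  have hK0 : (0 : ℝ) ≤ 3 * (K : ℝ) / 2 ^ 53 := by positivity
  have hvnn : 0 ≤ |(hornerExact l : ℝ)| := abs_nonneg _
  rcases hornerRd_inv hsm hint l hlow hK with hex | ⟨hbig, herr⟩
  · rw [hex]
    refine ⟨by nlinarith, ?_⟩
    rcases eq_or_ne (hornerExact l) 0 with h0 | h0
    · left; simp [h0]
    · right
      have : (1 : ℤ) ≤ |hornerExact l| := Int.one_le_abs h0
      exact_mod_cast this
  · have hlow' : (1 - 3 * (K : ℝ) / 2 ^ 53) * |(hornerExact l : ℝ)| ≤ |hornerRd rd l| := by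
      have := abs_sub_abs_le_abs_sub ((hornerExact l : ℤ) : ℝ) (hornerRd rd l)
      rw [abs_sub_comm] at this
      linarith
    refine ⟨hlow', Or.inr (le_trans ?_ hlow')⟩
    calc (1 : ℝ) ≤ (1 - 1 / 2 ^ 30) * (2 ^ 53 - 2 ^ 20) := by norm_num
      _ ≤ (1 - 3 * (K : ℝ) / 2 ^ 53) * |(hornerExact l : ℝ)| :=
          mul_le_mul (by linarith) hbig (by norm_num) (by linarith)

end Summit.Ventures.CertifiedManyBodySolver.Upper.IntervalReader

end
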